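import Literature.NumberTheory.LFunctions.Zhang2022.KnifeEdgeLenZDegreeShortPolyDense
import Literature.NumberTheory.LFunctions.Zhang2022.Section7MeanSquareMajorant
import Literature.NumberTheory.Sieve.LargeSieveCharacters
import HarnessLib

/-!
# K-len knife edge, long-leg split: the WALL GATE of the long sub-unit poly class — which pairs are LONG (by name), their
# E1-excess, and the Parseval floor behind the dual-large-sieve loss

Y. Zhang, *Discrete mean estimates and the Landau–Siegel zero*, arXiv:2211.02515v1 [Zhang2022LandauSiegel] — an
unrefereed manuscript under adjudication; nothing here asserts any of its claims and nothing here is a statement about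
Landau–Siegel zeros. Typer leaf of the §D toeplitz cell (ls-knife-toeplitz-typer-1, S4 display
`K1A-DISPLAY-6-U-WRAP.md`: the Leg-B wrap of the degree-2 cell on LONG sub-unit poly pairs admits only the dual-large-sieve
upper bound `P^{(θ_f+θ_g−1)/2+o(1)}·𝔞𝔓` and no lower bound). Everything below is (A)-free and PROVED; no new `Prop`, no
`def`.

* **Part 1 — a piece that does not vanish below `θ` is short of no length `< θ`.** `ShortPiece.le_of_ne_zero_below`: if
  `u y ≠ 0` for all `y < θ` then every representation `ShortPiece θ′ u u′` has `θ ≤ θ′`; `polyPiece_linear_ne_zero`: the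
  linear poly piece `θ − X` is non-zero below `θ`; hence `le_of_shortPiece_linearPiece` and
  **`not_shortPairs_linearPiece`**: two linear sub-unit poly pieces of lengths `θ_f + θ_g ≥ 1` form a LONG pair
  (`¬ ShortPairs`), in particular the S4 display design `(9/10, 9/10)` (`not_shortPairs_linearPiece_nine_tenths`) — the
  linear twin of `Negative.SubUnitTwistThreshold.not_shortPairs_kappaP_nine_tenths` (twisted pieces).
* **Part 2 — the E1-excess of a long sub-unit pair.** `one_le_add_of_not_shortPairs`: if `f`, `g` are short of lengths
  `θ_f`, `θ_g` and the pair is long then `1 ≤ θ_f + θ_g`; so on the sub-unit class the excess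
  `u := θ_f + θ_g − 1` (log_P-length of the long k-side datum of Leg B over the printed range (7.2)) satisfies
  `0 ≤ u < 1` (`excess_range_of_long_subunit`).
* **Part 3 — the Parseval floor at a prime exceeding the support** (multiplicative twin of
  `Literature.Barriers.Parity.LargeSieveLevelHalfNarrow` clause (1), from the tree's Parseval on `(ℤ/rℤ)ˣ`,
  `LargeSieve.sum_norm_sq_sum_char_mul`): for a prime `r` and a sequence supported on `1 ≤ n ≤ N < r`,
  `Σ_{χ mod r} ‖Σ_n c(n)χ(n)‖² = (r − 1)·Σ_n ‖c(n)‖²` (`sum_char_norm_sq_eq_of_lt_prime`) and, dropping the principal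
  character, `Σ_{χ ≠ 1} ‖Σ_n c(n)χ(n)‖² ≥ (r − 1 − N)·Σ_n ‖c(n)‖²` (`sum_nonprincipal_norm_sq_ge_of_lt_prime`): EVERY
  sequence shorter than a prime modulus pays `r − 1 − N` per modulus in the character mean square — the `R²` term of the
  large-sieve factor `(R² + P)P³` in (7.15) [Zhang2022LandauSiegel, §7 p.14] for the prime sum `Σ_{p∼P} θ̄(p)p^{s}`
  against characters to moduli `r > P` is therefore incurred by every choice of coefficients, i.e. that large-sieve
  step is lossless; the `P^{u/2}` of the wall is the absolute-value/Cauchy–Schwarz step upstream of it (ESTAR E1).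
* **Part 4 — the ψ-side head of Leg B is AUTOMORPHIC.** In Leg B the long-leg cell's tiny ψ-side datum `ν·1_{≤D⁴}`
  (`Skeleton.nu χ = 1 ⋆ χ`, `divisorSumChar`) is convolved with Zhang's `κ` (coefficients of
  `ζ(s+β₁)ζ(s+β₂)ζ(s+β₃)/ζ(s)`, tree `MeanSquareMajorant.kappa b₁ b₂ b₃ = powI b₁ * powI b₂ * powI b₃ * μ`); since
  `μ ⋆ ζ = 1` the Möbius factor CANCELS: `kappa_mul_zeta_mul` (`κ * (ζ * f) = powI b₁ * powI b₂ * powI b₃ * f` for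
  every `f`), `toArithmeticFunction_nu` (`ν = ζ * χ` as arithmetic functions), **`kappa_mul_nu`** (`κ ⋆ ν =
  n^{−β₁} ⋆ n^{−β₂} ⋆ n^{−β₃} ⋆ χ`, the coefficients of `ζ(s+β₁)ζ(s+β₂)ζ(s+β₃)L(s,χ)` — a `GL₁⁴` Eisenstein-type
  sequence), and **`kappa_mul_truncNu_eq`** (the identity survives the truncation of `ν` at
  `D⁴` exactly for `m ≤ D⁴`). This is the kernel anchor of the S4 display's census row (l): the loss-bearing
  large-sieve factor at locus (a′) is a family variance of a STRUCTURED (automorphic) sequence, not of arbitrary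
  coefficients.

References: [Zhang2022LandauSiegel, §7 (7.2) p.13, (7.12)–(7.15) p.14]; H. L. Montgomery, *The analytic principle of
the large sieve*, Bull. AMS 84 (1978) 547–567 [Montgomery1978, p.548] (necessity of the two terms of the large-sieve
constant). «The programme SEARCHES and TYPES; no claim about Landau–Siegel zeros, Theorems 1–2 of arXiv:2211.02515 or a
repaired Margin232 until a kernel theorem says so.»
-/

noncomputable section

open Complex Real Polynomial Finset

namespace Literature.NumberTheory.LFunctions.Zhang2022.KnifeEdge.LongLegWall

open Literature.NumberTheory.LFunctions.Zhang2022.KnifeEdge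

/-! ### Part 1 — which sub-unit poly pairs are LONG -/

section Long

variable {u u' : ℝ → ℂ} {θ θ' : ℝ}

/-- A piece that is non-zero everywhere below `θ` is short of length `θ′` only if `θ ≤ θ′`.
[cite: Zhang2022LandauSiegel, §7 (7.2) p.13] -/
theorem ShortPiece.le_of_ne_zero_below (h : ShortPiece θ' u u') (hne : ∀ y, y < θ → u y ≠ 0) : θ ≤ θ' := by
  by_contra hlt
  push Not at hlt
  -- `y := max θ′ (θ − 1)` lies in `[θ′, θ)`: `u y = 0` by shortness, `u y ≠ 0` by hypothesis
  have hy1 : max θ' (θ - 1) < θ := max_lt hlt (by linarith)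
  have hy2 : θ' ≤ max θ' (θ - 1) := le_max_left _ _
  exact hne _ hy1 (h.vanish _ hy2)

/-- The linear poly piece `θ − X` takes the value `θ − y ≠ 0` at every `y < θ`. [cite: Zhang2022LandauSiegel, §7 (7.2) p.13] -/
theorem polyPiece_linear_ne_zero {y : ℝ} (hy : y < θ) : polyPiece θ (C (θ : ℂ) - X) y ≠ 0 := by
  rw [polyPiece_of_lt hy, eval_sub, eval_C, eval_X, ← Complex.ofReal_sub, Complex.ofReal_ne_zero]
  exact (sub_pos.mpr hy).ne'

/-- The linear poly piece of length `θ` is short of length `θ′` only if `θ ≤ θ′` (whatever the marked derivative).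
[cite: Zhang2022LandauSiegel, §7 (7.2) p.13] -/
theorem le_of_shortPiece_linearPiece (h : ShortPiece θ' (polyPiece θ (C (θ : ℂ) - X)) u') : θ ≤ θ' :=
  ShortPiece.le_of_ne_zero_below h fun _ hy => polyPiece_linear_ne_zero hy

/-- **A pair whose pieces admit no short representation below `θ_f`, `θ_g` with `θ_f + θ_g ≥ 1` is LONG.**
[cite: Zhang2022LandauSiegel, §7 (7.2) p.13, §8 Lemma 8.1 p.16] -/
theorem not_shortPairs_of_le {f f' g g' : ℝ → ℂ} {θf θg : ℝ} (hf : ∀ θ, ShortPiece θ f f' → θf ≤ θ)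
    (hg : ∀ θ, ShortPiece θ g g' → θg ≤ θ) (hsum : 1 ≤ θf + θg) : ¬ ShortPairs f f' g g' := by
  rintro ⟨θ₁, θ₂, hlt, h₁, h₂⟩
  have := hf θ₁ h₁
  have := hg θ₂ h₂
  linarith

/-- **Two linear sub-unit poly pieces of lengths `θ_f + θ_g ≥ 1` form a LONG pair** (`¬ ShortPairs`), for any marked
derivatives. [cite: Zhang2022LandauSiegel, §7 (7.2) p.13, §8 Lemma 8.1 p.16] -/
theorem not_shortPairs_linearPiece {θf θg : ℝ} {f' g' : ℝ → ℂ} (hsum : 1 ≤ θf + θg) :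
    ¬ ShortPairs (polyPiece θf (C (θf : ℂ) - X)) f' (polyPiece θg (C (θg : ℂ) - X)) g' :=
  not_shortPairs_of_le (fun _ h => le_of_shortPiece_linearPiece h) (fun _ h => le_of_shortPiece_linearPiece h) hsum

/-- The S4 display design: the pair of linear poly pieces of length `9/10` is LONG (`9/10 + 9/10 ≥ 1`).
[cite: Zhang2022LandauSiegel, §7 (7.2) p.13] -/
theorem not_shortPairs_linearPiece_nine_tenths {f' g' : ℝ → ℂ} :
    ¬ ShortPairs (polyPiece (9/10) (C ((9/10 : ℝ) : ℂ) - X)) f' (polyPiece (9/10) (C ((9/10 : ℝ) : ℂ) - X)) g' :=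
  not_shortPairs_linearPiece (by norm_num)

/-- The length of the linear poly piece is exact also as a POLYNOMIAL short piece: `PolyShortPiece θ′` forces `θ ≤ θ′`.
[cite: Zhang2022LandauSiegel, §7 (7.2) p.13] -/
theorem le_of_polyShortPiece_linearPiece
    (h : PolyShortPiece θ' (polyPiece θ (C (θ : ℂ) - X)) (polyPieceDeriv θ (C (θ : ℂ) - X))) : θ ≤ θ' :=
  le_of_shortPiece_linearPiece h.shortPiece

end Long

/-! ### Part 2 — the E1-excess of a long pair of short pieces -/

section Excess

variable {f f' g g' : ℝ → ℂ} {θf θg : ℝ}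

/-- **A long pair of short pieces has `θ_f + θ_g ≥ 1`** (contrapositive of the definition of `ShortPairs`).
[cite: Zhang2022LandauSiegel, §7 (7.2) p.13] -/
theorem one_le_add_of_not_shortPairs (hf : ShortPiece θf f f') (hg : ShortPiece θg g g')
    (hlong : ¬ ShortPairs f f' g g') : 1 ≤ θf + θg := by
  by_contra hlt
  exact hlong ⟨θf, θg, lt_of_not_ge hlt, hf, hg⟩

/-- On the SUB-UNIT class (both lengths `< 1`) the E1-excess `u = θ_f + θ_g − 1` of a long pair — the log_P-length of
the long k-side datum of Leg B over the printed range — lies in `[0, 1)`; the dual-large-sieve bound of the wrap exceeds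
its target by `P^{u/2 + o(1)}`. [cite: Zhang2022LandauSiegel, §7 (7.2) p.13, (7.15) p.14] -/
theorem excess_range_of_long_subunit (hf : ShortPiece θf f f') (hg : ShortPiece θg g g')
    (hθf : θf < 1) (hθg : θg < 1) (hlong : ¬ ShortPairs f f' g g') :
    0 ≤ θf + θg - 1 ∧ θf + θg - 1 < 1 := by
  have := one_le_add_of_not_shortPairs hf hg hlong
  constructor <;> linarith

/-- Polynomial version: a long pair of polynomial short pieces of lengths `θ_f, θ_g` has `1 ≤ θ_f + θ_g`.
[cite: Zhang2022LandauSiegel, §7 (7.2) p.13] -/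
theorem one_le_add_of_not_shortPairs_poly (hf : PolyShortPiece θf f f') (hg : PolyShortPiece θg g g')
    (hlong : ¬ ShortPairs f f' g g') : 1 ≤ θf + θg :=
  one_le_add_of_not_shortPairs hf.shortPiece hg.shortPiece hlong

end Excess

/-! ### Part 3 — the Parseval floor at a prime exceeding the support -/

section Floor

open Literature.NumberTheory.Sieve.LargeSieve

variable {r : ℕ} [NeZero r]

/-- **Parseval at a prime exceeding the support**: for a prime `r` and `c` on `1 ≤ n ≤ N` with `N < r`,
`Σ_{χ mod r} ‖Σ_{n ≤ N} c(n)χ(n)‖² = (r − 1)·Σ_{n ≤ N} ‖c(n)‖²` (the `n` are pairwise incongruent and coprime to `r`).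
[cite: Montgomery1978, p.548] -/
theorem sum_char_norm_sq_eq_of_lt_prime (hr : r.Prime) {N : ℕ} (hN : N < r) (c : ℕ → ℂ) :
    ∑ χ : DirichletCharacter ℂ r, ‖∑ n ∈ Icc 1 N, c n * χ n‖ ^ 2 = ((r : ℝ) - 1) * ∑ n ∈ Icc 1 N, ‖c n‖ ^ 2 := by
  classical
  -- extend `c` by zero outside `[1, N]` and apply Parseval on `range r`
  set c' : ℕ → ℂ := fun n => if n ∈ Icc 1 N then c n else 0 with hc'
  have hin : ∀ n ∈ Icc 1 N, c' n = c n := fun n hn => by simp only [hc', if_pos hn]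
  have hout : ∀ b, b ∉ Icc 1 N → c' b = 0 := fun b hb => by simp only [hc', if_neg hb]
  have hsub : Icc 1 N ⊆ range r := by
    intro n hn
    rw [mem_Icc] at hn
    exact mem_range.mpr (by omega)
  have hinner : ∀ χ : DirichletCharacter ℂ r, ∑ n ∈ Icc 1 N, c n * χ n = ∑ b ∈ range r, χ b * c' b := by
    intro χ
    rw [← sum_subset hsub (fun b _ hb => by rw [hout b hb, mul_zero])]
    exact sum_congr rfl fun n hn => by rw [hin n hn, mul_comm]
  have hpar := sum_norm_sq_sum_char_mul (q := r) c'
  simp_rw [← hinner] at hpar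
  rw [hpar, Nat.totient_prime hr]
  -- the coprime `b < r` carrying `c'` are exactly `Icc 1 N`
  have hrhs : ∑ b ∈ range r with b.Coprime r, ‖c' b‖ ^ 2 = ∑ n ∈ Icc 1 N, ‖c n‖ ^ 2 := by
    rw [sum_filter, ← sum_subset hsub (fun b _ hb => by rw [hout b hb]; simp)]
    refine sum_congr rfl fun n hn => ?_
    have hcop : n.Coprime r := by
      rw [mem_Icc] at hn
      exact Nat.Coprime.symm (Nat.coprime_of_lt_prime (by omega) (by omega) hr)
    rw [if_pos hcop, hin n hn]
  rw [hrhs]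
  push_cast [Nat.cast_sub hr.one_le]
  ring

/-- **Every sequence shorter than a prime modulus pays the modulus** (non-principal characters): for a prime `r` and
`c` on `1 ≤ n ≤ N < r`, `Σ_{χ mod r, χ ≠ 1} ‖Σ_n c(n)χ(n)‖² ≥ (r − 1 − N)·Σ_n ‖c(n)‖²` — the principal character
contributes at most `N·Σ‖c(n)‖²` (Cauchy–Schwarz). Summed over primes `r ∼ R > N` this is the `R²`-term of the large
sieve, incurred by EVERY choice of coefficients: the second large-sieve factor of (7.15) cannot be improved for the
prime sum of length `P` against moduli `r > P`. [cite: Montgomery1978, p.548] -/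
theorem sum_nonprincipal_norm_sq_ge_of_lt_prime (hr : r.Prime) {N : ℕ} (hN : N < r) (c : ℕ → ℂ) :
    ((r : ℝ) - 1 - N) * ∑ n ∈ Icc 1 N, ‖c n‖ ^ 2 ≤
      ∑ χ ∈ (univ : Finset (DirichletCharacter ℂ r)).erase 1, ‖∑ n ∈ Icc 1 N, c n * χ n‖ ^ 2 := by
  classical
  have htot := sum_char_norm_sq_eq_of_lt_prime hr hN c
  rw [← Finset.sum_erase_add _ _ (mem_univ (1 : DirichletCharacter ℂ r))] at htot
  -- the principal term: `‖Σ c(n)·1(n)‖² ≤ N·Σ‖c(n)‖²`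
  have hone : ∀ n ∈ Icc 1 N, c n * (1 : DirichletCharacter ℂ r) n = c n := by
    intro n hn
    have hcop : n.Coprime r := by
      rw [mem_Icc] at hn
      exact Nat.Coprime.symm (Nat.coprime_of_lt_prime (by omega) (by omega) hr)
    rw [MulChar.one_apply ((ZMod.isUnit_iff_coprime n r).mpr hcop), mul_one]
  have hprin : ‖∑ n ∈ Icc 1 N, c n * (1 : DirichletCharacter ℂ r) n‖ ^ 2 ≤ (N : ℝ) * ∑ n ∈ Icc 1 N, ‖c n‖ ^ 2 := by
    rw [sum_congr rfl hone]
    have hcs := norm_sum_le (Icc 1 N) c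
    have hcs2 : (∑ n ∈ Icc 1 N, ‖c n‖) ^ 2 ≤ (#(Icc 1 N) : ℝ) * ∑ n ∈ Icc 1 N, ‖c n‖ ^ 2 := by
      have := sq_sum_le_card_mul_sum_sq (s := Icc 1 N) (f := fun n => ‖c n‖)
      exact_mod_cast this
    have hcard : (#(Icc 1 N) : ℝ) = N := by simp
    rw [hcard] at hcs2
    calc ‖∑ n ∈ Icc 1 N, c n‖ ^ 2 ≤ (∑ n ∈ Icc 1 N, ‖c n‖) ^ 2 := by
          exact pow_le_pow_left₀ (norm_nonneg _) hcs 2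
      _ ≤ (N : ℝ) * ∑ n ∈ Icc 1 N, ‖c n‖ ^ 2 := hcs2
  linarith

end Floor

/-! ### Part 4 — the ψ-side head of Leg B is automorphic: `κ ⋆ ν = n^{−β₁} ⋆ n^{−β₂} ⋆ n^{−β₃} ⋆ χ` -/

section Head

open ArithmeticFunction Literature.NumberTheory.LFunctions.Zhang2022.MeanSquareMajorant

/-- **The Möbius factor of `κ` cancels against a `ζ`-factor**: for every arithmetic function `f`,
`κ * (ζ * f) = powI b₁ * powI b₂ * powI b₃ * f` (`κ = powI b₁ * powI b₂ * powI b₃ * μ`, `μ * ζ = 1`).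
[cite: Zhang2022LandauSiegel, §7 p.13 (definition of κ)] -/
theorem kappa_mul_zeta_mul (b₁ b₂ b₃ : ℝ) (f : ArithmeticFunction ℂ) :
    kappa b₁ b₂ b₃ * (((ArithmeticFunction.zeta : ArithmeticFunction ℕ) : ArithmeticFunction ℂ) * f) =
      powI b₁ * powI b₂ * powI b₃ * f := by
  rw [kappa, mul_assoc (powI b₁ * powI b₂ * powI b₃), ← mul_assoc ((ArithmeticFunction.moebius : ArithmeticFunction ℤ) : ArithmeticFunction ℂ),
    coe_moebius_mul_coe_zeta, one_mul]

variable {D : ℕ} (χ : DirichletCharacter ℂ D)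

/-- `ν = 1 ⋆ χ` as arithmetic functions: `toArithmeticFunction (Skeleton.nu χ) = ζ * toArithmeticFunction χ`
(the tree's `divisorSumChar_eq_zeta_mul`, pointwise). [cite: Zhang2022LandauSiegel, §3 p.6] -/
theorem toArithmeticFunction_nu :
    toArithmeticFunction (Skeleton.nu χ) = ((ArithmeticFunction.zeta : ArithmeticFunction ℕ) : ArithmeticFunction ℂ) * toArithmeticFunction (χ ·) := by
  ext n
  by_cases hn : n = 0
  · subst hn; simp [toArithmeticFunction]
  · simp only [toArithmeticFunction, ArithmeticFunction.coe_mk, hn, if_false]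
    rw [Skeleton.nu, divisorSumChar_eq_zeta_mul]
    rfl

/-- **The Leg-B head is automorphic**: `κ ⋆ ν = powI b₁ * powI b₂ * powI b₃ * χ`, i.e. the Dirichlet coefficients of
`ζ(s+β₁)ζ(s+β₂)ζ(s+β₃)·L(s,χ)` (`β_j = ib_j`) — the `μ` of `κ` cancels against the `ζ` inside `ν = 1 ⋆ χ`.
[cite: Zhang2022LandauSiegel, §7 p.13, §3 p.6] -/
theorem kappa_mul_nu (b₁ b₂ b₃ : ℝ) :
    kappa b₁ b₂ b₃ * toArithmeticFunction (Skeleton.nu χ) = powI b₁ * powI b₂ * powI b₃ * toArithmeticFunction (χ ·) := by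
  rw [toArithmeticFunction_nu, kappa_mul_zeta_mul]

/-- Truncating the second factor above `N` does not change a Dirichlet convolution at arguments `m ≤ N` (every divisor
of `m` is `≤ m`). [folklore] -/
private theorem mul_trunc_apply_eq (κ : ArithmeticFunction ℂ) (a : ℕ → ℂ) {N m : ℕ} (hm : m ≤ N) :
    (κ * toArithmeticFunction (Skeleton.trunc N a)) m = (κ * toArithmeticFunction a) m := by
  rw [mul_apply, mul_apply]
  refine sum_congr rfl fun x hx => ?_
  have hx2 : x.2 ∣ m := (Nat.mem_divisorsAntidiagonal.mp hx).1 ▸ Dvd.intro_left _ rfl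
  have hm0 : m ≠ 0 := (Nat.mem_divisorsAntidiagonal.mp hx).2
  have hle : x.2 ≤ N := (Nat.le_of_dvd (Nat.pos_of_ne_zero hm0) hx2).trans hm
  simp only [toArithmeticFunction, ArithmeticFunction.coe_mk, Skeleton.trunc, hle, if_true]

/-- **Exactness below the truncation**: with the cell's truncated datum `ν·1_{≤D⁴}` (`Skeleton.trunc (D^4) (Skeleton.nu χ)`,
the coefficient sequence of `LongLegSplit.nuHead`), `(κ ⋆ ν·1_{≤D⁴})(m) = (powI b₁ * powI b₂ * powI b₃ * χ)(m)` for
every `m ≤ D⁴`; beyond `D⁴` the two sides differ by `(κ ⋆ ν·1_{>D⁴})(m)`. [cite: Zhang2022LandauSiegel, §7 p.13, §4 p.7] -/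
theorem kappa_mul_truncNu_eq (b₁ b₂ b₃ : ℝ) {m : ℕ} (hm : m ≤ D ^ 4) :
    (kappa b₁ b₂ b₃ * toArithmeticFunction (Skeleton.trunc (D ^ 4) (Skeleton.nu χ))) m =
      (powI b₁ * powI b₂ * powI b₃ * toArithmeticFunction (χ ·)) m := by
  rw [mul_trunc_apply_eq _ _ hm, kappa_mul_nu]

end Head

end Literature.NumberTheory.LFunctions.Zhang2022.KnifeEdge.LongLegWall

end
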